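import Summits.AtomisticToContinuum.Crystallization.Theses.FrustrationRangeCertificates
import Summits.AtomisticToContinuum.Crystallization.Theorems.ChargedEnergyGap.Negative.Unconditional

/-!
# Route `FrustrationRangeCertificates`, item stmt-AtomisticToContinuum-12976 `CertificatesEnergyLimit`

The ENERGY HINGE of the route:
`PatternPricedCertificates → TrialStateUpper → CrysPeriodicMinAttained → CrysEnergyLimit`.

Its conclusion `CrysEnergyLimit` (shared item stmt-AtomisticToContinuum-0626:
`E(N)/N → ⨅_{Q periodic} e_LJ(Q)` for Lennard-Jones in `ℝ³`) is already an unconditional in-tree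
theorem, `Summit.AtomisticToContinuum.Crystallization.Theorems.ChargedEnergyGapNegative.crysEnergyLimit`
(module `…Theorems.ChargedEnergyGap.Negative.Unconditional`): the thermodynamic limit
`e_∞ = lim E(N)/N` exists (`BlancLewin2015_8_holds`), `e_∞ ≤ e(Q)` for every periodic `Q`
(blocks of `Q` as trial states) and `⨅_Q e(Q) ≤ E(N)/N` for every `N ≥ 1` (periodisation of a
finite configuration with a large cubic period).  Hence the hinge closes by weakening: the three
hypotheses (the certificate family X, the trial-state upper bound and the attainment of the
periodic infimum) are not needed for this implication.  (The certificate bookkeeping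
`N·c + κ·#bad ≤ E(N)` sketched in the item text is the load-bearing content of the sibling hinge
`CertificatesDefectVanish`, stmt-AtomisticToContinuum-12977, not of this one.)
-/

namespace Summit.AtomisticToContinuum.Crystallization.Theorems

open Literature.MathematicalPhysics.StatisticalMechanics

/-- **Item stmt-AtomisticToContinuum-12976** (`CertificatesEnergyLimit`, route
`FrustrationRangeCertificates`): `PatternPricedCertificates → TrialStateUpper →
CrysPeriodicMinAttained → CrysEnergyLimit`.  The conclusion `E(N)/N → ⨅_{Q periodic} e_LJ(Q)`
holds unconditionally (`ChargedEnergyGapNegative.crysEnergyLimit`, item 0626), so the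
implication follows by discarding the hypotheses. -/
theorem certificatesEnergyLimit_proof :
    Summit.AtomisticToContinuum.Crystallization.Theses.FrustrationRangeCertificates.CertificatesEnergyLimit := by
  unfold Summit.AtomisticToContinuum.Crystallization.Theses.FrustrationRangeCertificates.CertificatesEnergyLimit
  intro _ _ _
  unfold Summit.AtomisticToContinuum.Crystallization.Theses.FrustrationRangeCertificates.CrysEnergyLimit
  exact ChargedEnergyGapNegative.crysEnergyLimit

end Summit.AtomisticToContinuum.Crystallization.Theorems
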